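import Literature.AlgebraicGeometry.AbelianSchemes.LevelStructureTwist
import Literature.AlgebraicGeometry.AbelianSchemes.AbelianSchemeOverSectionsBaseChange
import HarnessLib

/-!
# The `GL_{2g}(ℤ/N)`-twist of level structures commutes with base change

Cell hodgecm-mathlib, `B-plan/M1PRIME-DAG.md` P31 item (N) («naturality via (c4)», B-typ02's `LevelStructureTwist.lean`
docstring; B-plan1 2026-08-29T00:28:09Z: «files the hour P31 is ★»); writer B-p04 (by-paste certificate over P31
63466d5f4e296079 + (c4) 3d5db6f62cfd20b4 = `B-provers/B-p04/LevelStructureTwistNaturality.N.bypaste-P31-c4.B-p04g13.lean`,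
sha16 0b88ed07cb511310).

[MumfordFogartyKirwan1994, Ch. 7 §3 (p. 139)] lets `GL(2g, ℤ/n)` act on `𝒜_{g,d,n}` over `𝒜_{g,d,1}` by changing the
level structure (`LevelStructure.twist`, columns convention `η′ = η ∘ γ̄`; [Deligne1971TravauxShimura, 4.12 (b)]), and
[ibid., Ch. 7 §2 Definition 7.2 (p. 129), closing sentence] makes `𝒜_{g,d,n}(S)` a contravariant functor in `S` «in
the obvious way» (pull-back; the carrier's relation `LevelStructure.IsBaseChangeVia`).  Tacit in print: the action is
by NATURAL transformations of the moduli functor — pull-back and twist commute.  Here: if `(G, f)` identifies `φ′`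
with the pull-back of `φ`, it identifies `φ′·γ̄` with the pull-back of `φ·γ̄` (`LevelStructure.IsBaseChangeVia.twist`,
one line over `IsBaseChangeVia.sectionPow_comp` of `AbelianSchemeOverSectionsBaseChange.lean`), and conversely
(`twist_iff`, by twisting back with `γ̄⁻¹`).  Consumers: the Hecke correspondences `T_γ` of the W4 layer
(`classify` of the universal triple with twisted level) and their compatibility with the tower / with `Spec σ`.
Theorems only; HC_CM is proved only modulo the 7 printed citations until rung 0 closes — this file discharges none.

## References
* [MumfordFogartyKirwan1994] D. Mumford, J. Fogarty, F. Kirwan, *Geometric Invariant Theory*, 3rd ed., Ergebnisse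
  **34**, Springer (1994) — Ch. 7 §2 Definition 7.2 (p. 129), §3 (p. 139).
* [Deligne1971TravauxShimura] P. Deligne, *Travaux de Shimura*, Sém. Bourbaki 389 (1971), 4.12 (b) (p. 149).
-/

universe u

open CategoryTheory AlgebraicGeometry

noncomputable section

namespace Literature.AlgebraicGeometry.AbelianSchemes.AbelianSchemeOver.LevelStructure.IsBaseChangeVia

variable {S S' : Scheme.{u}} {A' : AbelianSchemeOver S'} {A : AbelianSchemeOver S} {f : S' ⟶ S}
  {G : A'.X.left ⟶ A.X.left} {g N : ℕ} [IsCommMonObj A'.X] [IsCommMonObj A.X] [NeZero N]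
  {φ' : LevelStructure g N A'} {φ : LevelStructure g N A}

/-- **The twist is natural**: if `(G, f)` identifies the level structure `φ′` on `A′/S′` with the pull-back of `φ` on
`A/S` (`LevelStructure.IsBaseChangeVia`), then for every `γ̄ ∈ GL_{2g}(ℤ/N)` it identifies `φ′·γ̄` with the pull-back of
`φ·γ̄` — the `GL(2g, ℤ/n)`-action of [MumfordFogartyKirwan1994, Ch. 7 §3] by natural transformations of the moduli
functor of [ibid., Def. 7.2].  One line over `IsBaseChangeVia.sectionPow_comp` (compatible sections are closed under
Mumford's `σ^a`). [cite: MumfordFogartyKirwan1994, Ch. 7 §2 Definition 7.2 (p. 129) and §3 (p. 139)] -/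
theorem twist (h : φ'.IsBaseChangeVia φ f G) (γ : GL (Fin g ⊕ Fin g) (ZMod N)) :
    (φ'.twist γ).IsBaseChangeVia (φ.twist γ) f G := by
  refine ⟨h.1, fun i => ?_⟩
  rw [LevelStructure.twist_σ, LevelStructure.twist_σ]
  exact h.1.sectionPow_comp h.2 _

/-- Twisting both level structures by the same `γ̄ ∈ GL_{2g}(ℤ/N)` does not change the relation «`φ′` is the pull-back
of `φ` along `(G, f)`» (twist back by `γ̄⁻¹`: `LevelStructure.twist_mul`, `twist_one`).
[cite: MumfordFogartyKirwan1994, Ch. 7 §2 Definition 7.2 (p. 129) and §3 (p. 139)] -/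
theorem twist_iff (γ : GL (Fin g ⊕ Fin g) (ZMod N)) :
    (φ'.twist γ).IsBaseChangeVia (φ.twist γ) f G ↔ φ'.IsBaseChangeVia φ f G := by
  refine ⟨fun h => ?_, fun h => h.twist γ⟩
  have h' := h.twist γ⁻¹
  rwa [LevelStructure.twist_mul, LevelStructure.twist_mul, mul_inv_cancel, LevelStructure.twist_one,
    LevelStructure.twist_one] at h'

end Literature.AlgebraicGeometry.AbelianSchemes.AbelianSchemeOver.LevelStructure.IsBaseChangeVia

end
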